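import Literature.AlgebraicGeometry.Motives.ProjectiveSpaceFormDivisors
import Literature.AlgebraicGeometry.Motives.CartierDivisorIntersectionCycle
import Literature.AlgebraicGeometry.Motives.LinearSubspacesGenerateChow
import Literature.AlgebraicGeometry.Motives.ProjectiveSpaceLinearSubspaces
import HarnessLib

/-!
# Hyperplane sections of linear subspaces of `ℙᴺ`, and the degree of closed points

Two elementary inputs for the non-torsion of the classes of linear subspaces in the Chow groups of
`ℙᴺ_K` (via `c₁(𝒪(1)) ∩ -`, `Motives/ProjectiveSpaceHyperplaneSection`, and the degree on `CH₀`),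
on the tree's carriers (`IsLinearSubspacePoint r N (𝟙 ℙᴺ) w`, `Motives/LinearSubspacesGenerateChow`:
`w` is the generic point of an `r`-plane `V₊(L₁, …, L_{N-r})`; `CartierDivisor.primeInter`,
`Motives/CartierDivisorIntersectionCycle`: Fulton's `D · [V]` as a cycle; `ProjSpace.formDivisor`,
`Motives/ProjectiveSpaceFormDivisors`: the hyperplane `V₊(ℓ)` as an effective Cartier divisor):

* `IsLinearSubspacePoint.exists_eq_span_of_id` — the homogeneous prime of an `r`-plane point of `ℙᴺ`
  is `(L₁, …, L_{N-r})`, and `r ≤ N`;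
* `ProjSpace.exists_primeInter_formDivisor_eq_smul_of_isLinearSubspacePoint` — **a hyperplane
  section of an `r`-plane is a positive multiple of an `(r-1)`-plane**: for `1 ≤ r` and a linear form
  `ℓ ∉ 𝔭_w`, `V₊(ℓ) · [closure {w}] = a • [closure {w'}]` with `a ≥ 1` and `w'` the generic point of
  the `(r-1)`-plane `V₊(L₁, …, L_{N-r}, ℓ)` (Fulton, Def. 2.3: the Weil divisor of `V₊(ℓ)|_Π`; it is
  effective, supported on `Π ∩ V₊(ℓ) = Π'`, whose only point of dimension `r - 1` is its generic
  point, where the local equation is a non-unit; in fact `a = 1`, Example 2.5.1, not needed);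
* `eq_zero_of_zsmul_primeCycle_mem_ratTrivial_of_height_eq_zero` — **closed points of an integral
  proper `K`-scheme are not torsion in `CH₀`**: `b • [p] ∈ Rat₀(X)`, `dim closure {p} = 0` ⇒ `b = 0`
  (Fulton, Def. 1.4 / Thm. 1.4: push forward to `Spec K`, where `Rat₀ = 0` and
  `[p] ↦ [κ(p) : K]·[pt]`, `[κ(p) : K] ≠ 0`).

Also instances making `(projectiveSpace N K).left / .hom` integral, proper, locally of finite type
and compact under that spelling (the tree has them for the spelling `ProjSpace.P N K`).
Everything is proved; no named facts.

## References

* W. Fulton, *Intersection Theory*, 2nd ed., Springer (1998): Def. 1.4 and Thm. 1.4 (pp. 11–13),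
  Def. 2.3 (p. 33), Example 2.5.1 (p. 41). [Fulton1998]
* R. Hartshorne, *Algebraic Geometry*, GTM 52 (1977): I Ex. 2.11 (linear varieties). [Hartshorne1977]
-/

noncomputable section

universe u

open CategoryTheory AlgebraicGeometry Order Topology TopologicalSpace
open MvPolynomial (X C)
open Literature.AlgebraicGeometry.Motives.Segre Literature.AlgebraicGeometry.Motives.RatFn

attribute [local instance] MvPolynomial.gradedAlgebra

namespace Literature.AlgebraicGeometry.Motives

/-! ### `ℙᴺ` as a `K`-scheme: instances on the spelling `projectiveSpace N K` -/

namespace ProjSpace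

variable {N : ℕ} {K : Type u} [Field K]

/-- `ℙᴺ_K` (spelled `(projectiveSpace N K).left = P N K`) is integral. [folklore] -/
instance isIntegral_projectiveSpace_left : IsIntegral (projectiveSpace N K).left :=
  inferInstanceAs (IsIntegral (P N K))

/-- `ℙᴺ_K → Spec K` is proper (`isProper_projectiveSpace` of `Motives/VarietiesProperProofs` is not
imported here; `ProjSpace.isProper_over` is the same morphism). [folklore] -/
instance isProper_projectiveSpace_hom : IsProper (projectiveSpace N K).hom :=
  inferInstanceAs (IsProper ((P N K) ↘ Spec (.of K)))

/-- `ℙᴺ_K → Spec K` is locally of finite type. [folklore] -/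
instance locallyOfFiniteType_projectiveSpace_hom : LocallyOfFiniteType (projectiveSpace N K).hom :=
  inferInstance

/-- `ℙᴺ_K` (spelled `(projectiveSpace N K).left`) is compact. [folklore] -/
instance compactSpace_projectiveSpace_left : CompactSpace ↥(projectiveSpace N K).left :=
  inferInstanceAs (CompactSpace (P N K))

end ProjSpace

/-! ### Linear-subspace points of `ℙᴺ` itself: the homogeneous prime is `(L₁, …, L_{N-r})` -/

namespace IsLinearSubspacePoint

variable {N : ℕ} {K : Type u} [Field K]

/-- For an `r`-plane point `w` of `ℙᴺ` (w.r.t. `𝟙 ℙᴺ`) with equations `L`, the closure of `w` is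
`V₊(L)`. [folklore] -/
theorem closure_eq_of_id {r : ℕ} {w : ↥(projectiveSpace N K).left}
    {L : Fin (N - r) → MvPolynomial (Fin (N + 1)) K}
    (hL : ⇑(𝟙 (projectiveSpace N K) : projectiveSpace N K ⟶ _).left.base '' closure {w} =
      ProjectiveSpectrum.zeroLocus (MvPolynomial.homogeneousSubmodule (Fin (N + 1)) K) (Set.range L)) :
    closure {w} = ProjectiveSpectrum.zeroLocus (MvPolynomial.homogeneousSubmodule (Fin (N + 1)) K)
      (Set.range L) := by
  rw [← hL]
  change closure {w} = id '' closure {w}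
  rw [Set.image_id]

/-- **The homogeneous prime of an `r`-plane point of `ℙᴺ` is generated by its `N - r` linear
equations**, and `r ≤ N`: the generic point `ℓ` of `V₊(L)` (`exists_point_of_linearIndependent`) has
the same closure as `w`, hence equals `w`. [folklore] -/
theorem exists_eq_span_of_id {r : ℕ} {w : ↥(projectiveSpace N K).left}
    (hw : IsLinearSubspacePoint r N (𝟙 (projectiveSpace N K)) w) :
    ∃ L : Fin (N - r) → MvPolynomial (Fin (N + 1)) K, LinearIndependent K L ∧
      (∀ j, (L j).IsHomogeneous 1) ∧
      closure {w} = ProjectiveSpectrum.zeroLocus (MvPolynomial.homogeneousSubmodule (Fin (N + 1)) K)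
        (Set.range L) ∧
      ((ProjectiveSpectrum.asHomogeneousIdeal
        (𝒜 := MvPolynomial.homogeneousSubmodule (Fin (N + 1)) K) w).toIdeal = Ideal.span (Set.range L)) ∧
      r ≤ N := by
  obtain ⟨hht, L, hL, hhom, hcl⟩ := hw
  have hcl' := closure_eq_of_id hcl
  obtain ⟨ℓ, hℓ, hhtℓ, -⟩ := exists_point_of_linearIndependent L hL hhom (Nat.sub_le N r)
  have hset : ((ProjectiveSpectrum.asHomogeneousIdeal
      (𝒜 := MvPolynomial.homogeneousSubmodule (Fin (N + 1)) K) ℓ :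
        HomogeneousIdeal (MvPolynomial.homogeneousSubmodule (Fin (N + 1)) K)) :
          Set (MvPolynomial (Fin (N + 1)) K)) =
      (Ideal.span (Set.range L) : Set (MvPolynomial (Fin (N + 1)) K)) := by
    rw [← hℓ]
    rfl
  have hclℓ : closure {ℓ} = ProjectiveSpectrum.zeroLocus
      (MvPolynomial.homogeneousSubmodule (Fin (N + 1)) K) (Set.range L) := by
    rw [closure_singleton_eq_zeroLocus, hset, ProjectiveSpectrum.zeroLocus_span]
  have hwℓ : w = ℓ := eq_of_closure_singleton_eq (hcl'.trans hclℓ.symm)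
  subst hwℓ
  refine ⟨L, hL, hhom, hcl', hℓ, ?_⟩
  -- `r = height w = N - (N - r)` forces `r ≤ N`
  by_contra hrN
  push Not at hrN
  rw [hhtℓ] at hht
  have : (N - (N - r) : ℕ) = r := by exact_mod_cast hht
  omega

end IsLinearSubspacePoint

namespace ProjSpace

variable {N : ℕ} {K : Type u} [Field K]

/-! ### The hyperplane section of an `r`-plane -/

/-- **A hyperplane section of an `r`-plane is a positive multiple of an `(r-1)`-plane.** Let `w` be
an `r`-plane point of `ℙᴺ_K` (`IsLinearSubspacePoint r N (𝟙 ℙᴺ) w`, `1 ≤ r`), i.e. the generic point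
of `Π = V₊(L₁, …, L_{N-r})`, and `ℓ` a nonzero linear form with `ℓ ∉ 𝔭_w` (the hyperplane `V₊(ℓ)`
does not contain `Π`). Then the cycle `V₊(ℓ) · [Π]` (`CartierDivisor.primeInter` of the effective
Cartier divisor `formDivisor ℓ`, i.e. the Weil divisor of `V₊(ℓ)|_Π`, Fulton Def. 2.3) is
`a • [Π']` for the `(r-1)`-plane `Π' = V₊(L₁, …, L_{N-r}, ℓ)` and an integer `a ≥ 1`: it is an
effective `(r-1)`-cycle supported on `Π ∩ V₊(ℓ) = Π'`, whose only point of dimension `r - 1` is the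
generic point of `Π'`, and its coefficient there is the order of a non-unit, hence positive.
(In fact `a = 1`; positivity is all that is used.) [cite: Fulton1998, Def. 2.3 (p. 33) and Example 2.5.1] -/
theorem exists_primeInter_formDivisor_eq_smul_of_isLinearSubspacePoint {r : ℕ} (hr : 1 ≤ r)
    {w : ↥(projectiveSpace N K).left} (hw : IsLinearSubspacePoint r N (𝟙 (projectiveSpace N K)) w)
    {ℓ : MvPolynomial (Fin (N + 1)) K} (hℓ : ℓ ∈ grading (Fin (N + 1)) K 1) (hℓ0 : ℓ ≠ 0)
    (hℓw : ℓ ∉ (ProjectiveSpectrum.asHomogeneousIdeal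
      (𝒜 := MvPolynomial.homogeneousSubmodule (Fin (N + 1)) K) w)) :
    ∃ (w' : ↥(projectiveSpace N K).left) (a : ℤ), IsLinearSubspacePoint (r - 1) N (𝟙 (projectiveSpace N K)) w' ∧
      0 < a ∧ (formDivisor ℓ hℓ hℓ0).primeInter (X := projectiveSpace N K) w = a • primeCycle w' := by
  classical
  obtain ⟨L, hL, hhom, hcl, hspan, hrN⟩ := hw.exists_eq_span_of_id
  have hht : height w = r := hw.1
  -- the `(r-1)`-plane `Π' = V₊(L, ℓ)`
  have hℓspan : ℓ ∉ Submodule.span K (Set.range L) := by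
    intro h
    apply hℓw
    have h' : ℓ ∈ Ideal.span (Set.range L) := by
      have hle : Submodule.span K (Set.range L) ≤ (Ideal.span (Set.range L)).restrictScalars K :=
        Submodule.span_le.mpr Ideal.subset_span
      exact hle h
    change ℓ ∈ (ProjectiveSpectrum.asHomogeneousIdeal
      (𝒜 := MvPolynomial.homogeneousSubmodule (Fin (N + 1)) K) w).toIdeal
    rw [hspan]
    exact h'
  set L' : Fin (N - r + 1) → MvPolynomial (Fin (N + 1)) K := Fin.snoc L ℓ with hL'
  have hL'ind : LinearIndependent K L' := linearIndependent_finSnoc.2 ⟨hL, hℓspan⟩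
  have hL'hom : ∀ j, (L' j).IsHomogeneous 1 := by
    intro j
    refine Fin.lastCases ?_ (fun i => ?_) j
    · rw [hL', Fin.snoc_last]
      exact (MvPolynomial.mem_homogeneousSubmodule 1 ℓ).1 hℓ
    · rw [hL', Fin.snoc_castSucc]
      exact hhom i
  have hrange : Set.range L' = insert ℓ (Set.range L) := by
    ext g
    simp only [Set.mem_range, Set.mem_insert_iff]
    constructor
    · rintro ⟨j, rfl⟩
      refine Fin.lastCases ?_ (fun i => ?_) j
      · left; rw [hL', Fin.snoc_last]
      · right; exact ⟨i, by rw [hL', Fin.snoc_castSucc]⟩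
    · rintro (rfl | ⟨i, rfl⟩)
      · exact ⟨Fin.last _, by rw [hL', Fin.snoc_last]⟩
      · exact ⟨Fin.castSucc i, by rw [hL', Fin.snoc_castSucc]⟩
  obtain ⟨w', hw'span, hhtw', -⟩ :=
    exists_point_of_linearIndependent L' hL'ind hL'hom (by omega)
  have hhtw'' : height w' = ((r - 1 : ℕ) : ℕ∞) := by
    rw [hhtw']
    congr 1
    omega
  have hsetw' : ((ProjectiveSpectrum.asHomogeneousIdeal
      (𝒜 := MvPolynomial.homogeneousSubmodule (Fin (N + 1)) K) w' :
        HomogeneousIdeal (MvPolynomial.homogeneousSubmodule (Fin (N + 1)) K)) :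
          Set (MvPolynomial (Fin (N + 1)) K)) =
      (Ideal.span (Set.range L') : Set (MvPolynomial (Fin (N + 1)) K)) := by
    rw [← hw'span]
    rfl
  have hclw' : closure {w'} = ProjectiveSpectrum.zeroLocus
      (MvPolynomial.homogeneousSubmodule (Fin (N + 1)) K) (Set.range L') := by
    rw [closure_singleton_eq_zeroLocus, hsetw', ProjectiveSpectrum.zeroLocus_span]
  -- `Π' = Π ∩ V₊(ℓ)`
  have hclw'2 : closure {w'} = closure {w} ∩ ProjectiveSpectrum.zeroLocus
      (MvPolynomial.homogeneousSubmodule (Fin (N + 1)) K) {ℓ} := by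
    rw [hclw', hcl, hrange, Set.insert_eq, ProjectiveSpectrum.zeroLocus_union]
    exact Set.inter_comm _ _
  -- `w'` is an `(r-1)`-plane point (reindex `L'` by `Fin (N - (r - 1)) ≃ Fin (N - r + 1)`)
  have hcast : N - (r - 1) = N - r + 1 := by omega
  have hw'lin : IsLinearSubspacePoint (r - 1) N (𝟙 (projectiveSpace N K)) w' := by
    refine ⟨hhtw'', fun j => L' (Fin.cast hcast j), ?_, fun j => hL'hom _, ?_⟩
    · exact hL'ind.comp _ (Fin.cast_injective hcast)
    · have hr' : Set.range (fun j => L' (Fin.cast hcast j)) = Set.range L' := by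
        ext g
        constructor
        · rintro ⟨j, rfl⟩; exact ⟨_, rfl⟩
        · rintro ⟨j, rfl⟩; exact ⟨Fin.cast hcast.symm j, by simp⟩
      rw [hr']
      change id '' closure {w'} = _
      rw [Set.image_id, hclw']
  -- the cycle `V₊(ℓ) · [Π]`
  set H' : CartierDivisor (projectiveSpace N K).left := formDivisor ℓ hℓ hℓ0 with hH'
  have hH'e : H'.IsEffective := isEffective_formDivisor hℓ hℓ0
  have hH'w : H'.Avoids w := (formDivisor_avoids_iff hℓ hℓ0 zero_lt_one).2 hℓw
  set γ := H'.primeInter (X := projectiveSpace N K) w with hγ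
  have hγd : γ ∈ cyclesOfDim (projectiveSpace N K).left (r - 1) := by
    refine H'.primeInter_mem_cyclesOfDim ?_
    rw [hht]
    norm_cast
    omega
  -- its support is `{w'}`
  have hsuppt : ∀ x, γ x ≠ 0 → x = w' := by
    intro x hx
    have hwx : w ⤳ x := H'.specializes_of_primeInter_ne_zero hx
    have hℓx : ℓ ∈ ProjectiveSpectrum.asHomogeneousIdeal
        (𝒜 := MvPolynomial.homogeneousSubmodule (Fin (N + 1)) K) x := by
      by_contra h
      exact H'.not_avoids_of_primeInter_ne_zero hx ((formDivisor_avoids_iff hℓ hℓ0 zero_lt_one).2 h)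
    have hxw' : x ∈ closure {w'} := by
      rw [hclw'2]
      exact ⟨hwx.mem_closure, (ProjectiveSpectrum.mem_zeroLocus _ _ _).2 (Set.singleton_subset_iff.2 hℓx)⟩
    have hw'x : w' ⤳ x := specializes_iff_mem_closure.2 (by simpa using hxw')
    have hle : x ≤ w' := Scheme.le_iff_specializes.mpr hw'x
    by_cases heq : x = w'
    · exact heq
    · exfalso
      have hlt : x < w' := lt_of_le_not_ge hle fun hge =>
        heq ((hw'x.antisymm (Scheme.le_iff_specializes.mp hge)).eq.symm)
      have h1 := height_add_one_le hlt
      rw [hγd x hx, hhtw''] at h1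
      exact absurd h1 (by norm_cast; omega)
  have hγeq : γ = γ w' • primeCycle w' := by
    ext x
    simp only [Function.locallyFinsuppWithin.coe_zsmul, Pi.smul_apply, smul_eq_mul]
    by_cases hx : x = w'
    · subst hx
      rw [primeCycle_apply_self, mul_one]
    · rw [primeCycle_apply_of_ne hx, mul_zero]
      by_contra h
      exact hx (hsuppt x h)
  -- the coefficient at `w'` is positive
  have hww' : w ⤳ w' := by
    have : w' ∈ closure {w} := by
      have h := (subset_closure (Set.mem_singleton w') : w' ∈ closure {w'})
      rw [hclw'2] at h
      exact h.1
    exact specializes_iff_mem_closure.2 this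
  have hpos : 0 < γ w' := by
    rw [hγ, H'.primeInter_apply_of_specializes hww']
    have hH'gen : H'.Avoids ((ClosedSubvariety.ofPoint (projectiveSpace N K).left w).ι
        (genericPoint (ClosedSubvariety.ofPoint (projectiveSpace N K).left w).carrier)) := by
      change H'.Avoids (ClosedSubvariety.ofPoint (projectiveSpace N K).left w).genericPoint
      rw [ClosedSubvariety.genericPoint_ofPoint]
      exact hH'w
    rw [CartierDivisor.pullbackRep_of_avoids _ _ hH'gen]
    set V := ClosedSubvariety.ofPoint (projectiveSpace N K).left w
    set v : ↥V.carrier := ClosedSubvariety.ofPointPt w hww'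
    set E := H'.pullbackAvoiding V.ι hH'gen
    obtain ⟨i, hi⟩ := E.covers v
    -- `ℓ ∈ 𝔭_{w'}`: the local equation is not a unit at `v`
    have hℓw' : ℓ ∈ ProjectiveSpectrum.asHomogeneousIdeal
        (𝒜 := MvPolynomial.homogeneousSubmodule (Fin (N + 1)) K) w' := by
      change ℓ ∈ (ProjectiveSpectrum.asHomogeneousIdeal
        (𝒜 := MvPolynomial.homogeneousSubmodule (Fin (N + 1)) K) w').toIdeal
      rw [hw'span]
      exact Ideal.subset_span ⟨Fin.last _, by rw [hL', Fin.snoc_last]⟩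
    have hnav : ¬ H'.Avoids w' := fun h =>
      ((formDivisor_avoids_iff hℓ hℓ0 zero_lt_one).1 h) hℓw'
    have hu : ¬ IsUnitAt (V.ι v) (H'.f i.1) := by
      intro h
      exact hnav (CartierDivisor.Avoids.of_mem hi h)
    have hu' := (hH'e.not_isUnitAt_pullbackAvoiding V.ι hH'gen i hi hu)
    -- `codim_V v = 1`
    have hcoh : coheight v = 1 := by
      have hsum := Scheme.height_add_coheight_eq_height_top (V.over (projectiveSpace N K).hom).hom v
      change height v + coheight v = height (⊤ : ↥V.carrier) at hsum
      rw [height_top_ofPoint, hht, ← height_base_eq_of_isClosedImmersion' V.ι v] at hsum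
      change height w' + coheight v = r at hsum
      rw [hhtw''] at hsum
      have h1 : ((r - 1 : ℕ) : ℕ∞) + 1 = (r : ℕ∞) := by norm_cast; omega
      rw [← h1] at hsum
      exact WithTop.add_left_cancel (ENat.coe_ne_top _) hsum
    exact (hH'e.pullbackAvoiding V.ι hH'gen).ordAt_pos hi hu' hcoh
  exact ⟨w', γ w', hw'lin, hpos, hγeq⟩

end ProjSpace

/-! ### Closed points of proper varieties are not torsion in `CH₀` (the degree) -/

section Degree

variable {K : Type u} [Field K]

/-- **A closed point of an integral proper `K`-scheme is not torsion in `CH₀`** (Fulton,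
*Intersection Theory*, Def. 1.4 and Thm. 1.4: the degree `deg : CH₀(X) → ℤ = CH₀(Spec K)`,
`[P] ↦ [κ(P) : K]`): if `b • [p] ∈ Rat₀(X)` for a point `p` of dimension `0`, then `b = 0` — push
forward along the proper structure morphism `X → Spec K` (`map_mem_ratTrivial_holds`), where
`Rat₀(Spec K) = 0` and `[p] ↦ [κ(p) : K] · [pt]` with
`[κ(p) : K] ≠ 0` (`residueDegree_toSpecOver_ne_zero`). [cite: Fulton1998, Definition 1.4 and Theorem 1.4 (pp. 11–13)] -/
theorem eq_zero_of_zsmul_primeCycle_mem_ratTrivial_of_height_eq_zero (C : SchemeOver K)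
    [IsIntegral C.left] [IsProper C.hom] {p : ↥C.left} (hp : height p = 0) {b : ℤ}
    (hb : b • primeCycle p ∈ ratTrivial C.left 0) : b = 0 := by
  classical
  haveI : Subsingleton ↥(specOver K K).left := inferInstanceAs (Subsingleton (PrimeSpectrum K))
  -- `Rat₀(Spec K) = 0`: `Spec K` has no subvarieties of dimension `1` (this is
  -- `ratTrivial_specOver_self_eq_bot` of `Motives/GeneralisedDecompositionOfTheDiagonalProofs`,
  -- re-derived in place to keep that file's large import closure out of this one)
  have hbot : ratTrivial (specOver K K).left 0 = ⊥ := by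
    rw [ratTrivial, AddSubgroup.closure_eq_bot_iff]
    rintro c ⟨-, W, -, f, -, hdim, -⟩
    exfalso
    have h0 : W.dim = 0 := by
      change height W.genericPoint = 0
      rw [Subsingleton.elim W.genericPoint ⊤]
      exact CartierDivisor.height_top_specOver_self
    rw [h0] at hdim
    exact absurd hdim (by norm_cast)
  have h := map_mem_ratTrivial_holds 0 (toSpecOver C) hb
  rw [hbot, AddSubgroup.mem_bot] at h
  have h2 := congrArg (fun c : AlgebraicCycle (specOver K K).left ℤ => c ⊤) h
  simp only [Function.locallyFinsuppWithin.coe_zero, Pi.zero_apply] at h2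
  unfold AlgebraicCycle.map at h2
  rw [Function.locallyFinsupp.map_apply,
    show (toSpecOver C).left.base ⁻¹' {⊤} = Set.univ from Set.eq_univ_of_forall fun x => Subsingleton.elim _ _,
    finsum_mem_univ, finsum_eq_single _ p (fun x hx => by
      simp [primeCycle_apply_of_ne hx])] at h2
  simp only [Function.locallyFinsuppWithin.coe_zsmul, Pi.smul_apply, smul_eq_mul, primeCycle_apply_self,
    mul_one, CartierDivisor.mapCoeff_toSpecOver_eq] at h2
  exact (mul_eq_zero.mp h2).resolve_right (by
    exact_mod_cast CartierDivisor.residueDegree_toSpecOver_ne_zero (C := C) hp)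

end Degree

end Literature.AlgebraicGeometry.Motives

end
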